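import Summits.BirchSwinnertonDyer.BirchSwinnertonDyer.Theorems.CyclotomicUntwistSigmaLineFamilyParallelogram
import Literature.NumberTheory.EllipticCurves.CanonicalPAdicHeightLeavesProofs
import Literature.NumberTheory.EllipticCurves.PadicPointsFiltration
import HarnessLib

/-!
# Route `CyclotomicUntwist`, crux K1 `PSRankOneLowerHalfAtThree` (stmt-BirchSwinnertonDyer-21580):
# the σ-LINE FAMILY — EXISTENCE OF THE σ_c-HEIGHT DATUM: for every globally minimal `E/ℚ`, every ODD
# prime `p` (ANY reduction type) and every `c ∈ ℤ_p`, a symmetric bilinear torsion-vanishing pairing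
# on `E(ℚ)` whose quadratic form on the deep admissible locus is the `σ_c` sigma height

Cell `pub/bsd-wall` (D-0145 line `route-BirchSwinnertonDyer-CyclotomicUntwist`), seat `bsd-line-cycu-p1`
g4 (K1 base). THEOREMS ONLY (no definition, no named fact, no `sorry`); helper `--supports` K1 =
stmt-BirchSwinnertonDyer-21580. Sequel of `…SigmaLineFamilyParallelogram.lean`. BSD is not proved by this
file and nothing here is evidence for or against K1/K2.

WHY. The route's D2 (`PSLineHeightData`) and the census cell's `IsTwistSigmaHeight` /
`PAdicHeightData` are HYPOTHESIS STRUCTURES, documented as junk-inhabitable ("no existence smuggled";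
census: «existence of a BILINEAR datum with this quadratic form (Bernardi quadraticity of `σ_c`-heights
at an additive prime) is not a tree theorem»). The tree constructs a genuine datum only at good ORDINARY
`p ≥ 5` (`exists_isCanonical`, Mazur–Tate's integral `σ_p`). This file constructs one for EVERY member
`σ_c` (`c ∈ ℤ_p`) of the formal sigma family at EVERY odd prime — in particular at the route's additive
`p = 3` — by the tree's own road (MST 2006 §1/§2.7): parallelogram law on a finite-index torsion-free
subgroup, Jordan–von Neumann, extension by injectivity of `ℚ_p`:

* `deep_of_mem_filtration` — `‖x‖ > 1 ∧ ‖z‖ ≤ p⁻³ ⇒ ‖x‖ > p⁴`;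
* **`exists_heightDatum_formalSigma`** — for `W/ℚ` globally minimal, `p` odd, `‖c‖ ≤ 1`:
  `∃ D : PAdicHeightData W p`, `D(P,P) = CensusX42.sigmaHeight W p (formalSigma (W ⊗ ℚ_p) c) P` for every
  `P = (x,y) ∈ E(ℚ)` with `‖x‖_p > 1`, `‖z(P)‖_p ≤ p⁻³` and non-singular reduction at every prime (the
  subgroup `E⁽³⁾ ∩ ⋂_ℓ E⁰(ℚ_ℓ)` = tree `formalFiltration 3` ⊓ `nonsingularReductionSubgroupAt`, torsion-free
  by `not_isOfFinAddOrder_of_one_lt_padicNorm_holds`; parallelogram on generic pairs =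
  `sigmaHeight_formalSigma_parallelogram`; `parallelogram_of_generic`; `exists_pairing_of_parallelogram`).

Consequences (not restated): every non-torsion point has a multiple in that subgroup (tree
`exists_admissible_nsmul_holds` followed by `p²·`), so `D` is DETERMINED by `c` on `E(ℚ) ⊗ ℚ`
(`PAdicHeightData.isCanonical_unique`-style); by the height difference law the data for two constants
differ by `(c₂ − c₁)·ℓ ⊗ ℓ` with `ℓ` the logarithm; the `R`-valued affine members (`c ∈ ℚ₃(ζ₃)`: the
route's `ψ`-lines, once D5 pins `c_ψ`) are `ι ∘ D_{c₀} + (c − ι c₀)·ℓ ⊗ ℓ`. What is NOT here: `p = 2`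
(torsion in `E₁(ℚ₂)`; use `E⁽²⁾`), and any identification of a particular `c` with a `p`-adic-Hodge
splitting (D5).

References: Mazur–Stein–Tate, Doc. Math. Extra Vol. (2006) §1, §2.6–2.7; Bernardi, Progr. Math. 12
(1981) §1; Stein–Wuthrich, Math. Comp. 82 (2013) §4.1 (4.1); Schneider, Invent. Math. 69 (1982) §1;
Silverman AEC IV.3.2, VII.2.2. [cite: MazurSteinTate2006, §2.7] [cite: SteinWuthrich2013, §4.1 eq. (4.1)]
[cite: Schneider1982PadicHeightI, §1] [cite: SilvermanAEC2009, VII.2.2]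
-/

set_option autoImplicit false
-- single-conjunct summit: `Summit.BirchSwinnertonDyer.BirchSwinnertonDyer.…` repeats the name by design
set_option linter.dupNamespace false

noncomputable section

open scoped Classical

open PowerSeries WeierstrassCurve Literature.NumberTheory.EllipticCurves
  Summit.BirchSwinnertonDyer.Rank1Residual.Additive
  Summit.BirchSwinnertonDyer.BirchSwinnertonDyer.Theorems.PSSigmaLineFamilyParallelogram

namespace Summit.BirchSwinnertonDyer.BirchSwinnertonDyer.Theorems.PSSigmaLineFamilyHeightDatum

variable {p : ℕ} [Fact p.Prime] (W : WeierstrassCurve ℚ) [W.IsElliptic] [W.IsGloballyMinimal]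

omit [W.IsElliptic] in
/-- From `‖x‖ > 1` and `‖z‖ ≤ p⁻³` (membership in the formal filtration `E⁽³⁾`): `‖x‖ > p⁴`
(`‖z‖² = ‖x‖⁻¹`). [Silverman AEC VII.2.2, IV.3.2] [folklore] -/
theorem deep_of_mem_filtration {x y : ℚ_[p]} (heq : (W.baseChange ℚ_[p]).toAffine.Equation x y) (hx : 1 < ‖x‖)
    (hz : ‖-x / y‖ ≤ ((p : ℝ)⁻¹) ^ 3) : (p : ℝ) ^ 4 < ‖x‖ := by
  have hp : (1 : ℝ) < p := by exact_mod_cast (Fact.out : p.Prime).one_lt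
  have hp0 : (0 : ℝ) < p := by positivity
  have hsq := (W.baseChange ℚ_[p]).norm_formalParameter_sq heq hx
  have hx0 : 0 < ‖x‖ := one_pos.trans hx
  have hz2 : ‖-x / y‖ ^ 2 ≤ (((p : ℝ)⁻¹) ^ 3) ^ 2 := pow_le_pow_left₀ (norm_nonneg _) hz 2
  rw [hsq] at hz2
  have h6 : (((p : ℝ)⁻¹) ^ 3) ^ 2 = ((p : ℝ) ^ 6)⁻¹ := by rw [← pow_mul, inv_pow]
  rw [h6] at hz2
  have hx6 : (p : ℝ) ^ 6 ≤ ‖x‖ := by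
    have := inv_anti₀ (inv_pos.mpr hx0) hz2
    rwa [inv_inv, inv_inv] at this
  calc (p : ℝ) ^ 4 < (p : ℝ) ^ 6 := pow_lt_pow_right₀ hp (by norm_num)
    _ ≤ ‖x‖ := hx6

/-- **EXISTENCE OF THE σ_c-HEIGHT DATUM (Bernardi quadraticity at an arbitrary odd prime, made a
bilinear pairing).** For `W/ℚ` globally minimal, an ODD prime `p` (ANY reduction type — additive
allowed), and `c ∈ ℤ_p`: there is a symmetric bilinear torsion-vanishing pairing
`D : E(ℚ) × E(ℚ) → ℚ_p` (`PAdicHeightData W p`) whose quadratic form on the DEEP ADMISSIBLE LOCUS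
(`P = (x,y)` with `‖x‖_p > 1`, `‖z(P)‖_p ≤ p⁻³`, non-singular reduction at every prime — a finite-index
torsion-free subgroup with `O`) IS the sigma height of the member `σ_c` of the formal sigma family,
`D(P,P) = log_p den x − 2 log_p σ_c(z(P))` (`CensusX42.sigmaHeight`). Proof: the locus is the subgroup
`E⁽³⁾ ∩ ⋂_ℓ E⁰(ℚ_ℓ)` (tree `formalFiltration`, `nonsingularReductionSubgroupAt`), torsion-free for odd
`p` (`not_isOfFinAddOrder_of_one_lt_padicNorm_holds`); the parallelogram law on generic pairs is
`sigmaHeight_formalSigma_parallelogram`; then `parallelogram_of_generic` and Jordan–von Neumann on a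
subgroup (`exists_pairing_of_parallelogram`). So the census's `IsTwistSigmaHeight`-type predicates and
a D5 pin «`h_ψ` = σ-height of a member» are INHABITED BY CONSTRUCTION at additive primes (non-junk).
[Mazur–Stein–Tate 2006, §1 ("extends uniquely"), §2.6–2.7; Bernardi 1981, §1; Stein–Wuthrich 2013, §4.1]
[cite: MazurSteinTate2006, §2.7] [cite: SteinWuthrich2013, §4.1 eq. (4.1)] -/
theorem exists_heightDatum_formalSigma (hp3 : 3 ≤ p) {c : ℚ_[p]} (hc : ‖c‖ ≤ 1) :
    ∃ D : PAdicHeightData W p, ∀ {x y : ℚ} (h : W.toAffine.Nonsingular x y),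
      1 < ‖(x : ℚ_[p])‖ → ‖(-(x : ℚ_[p]) / (y : ℚ_[p]))‖ ≤ ((p : ℝ)⁻¹) ^ 3 →
        (∀ ℓ : ℕ, ℓ.Prime → W.HasNonsingularReductionAt ℓ x y) →
          D.pairing (.some x y h) (.some x y h) =
            CensusX42.sigmaHeight W p ((W.baseChange ℚ_[p]).formalSigma c) (.some x y h) := by
  -- the subgroup `E⁽³⁾ ∩ ⋂ E⁰`
  set H : AddSubgroup W.toAffine.Point :=
    ((W.baseChange ℚ_[p]).formalFiltration 3).comap (W.toPadicPoint p) ⊓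
      ⨅ ℓ : Nat.Primes, (haveI : Fact ℓ.1.Prime := ⟨ℓ.2⟩; W.nonsingularReductionSubgroupAt ℓ.1) with hHdef
  -- membership of affine points
  have hmem_some : ∀ {x y : ℚ} (h : W.toAffine.Nonsingular x y),
      (.some x y h : W.toAffine.Point) ∈ H ↔
        (1 < ‖(x : ℚ_[p])‖ ∧ ‖(-(x : ℚ_[p]) / (y : ℚ_[p]))‖ ≤ ((p : ℝ)⁻¹) ^ 3) ∧
          ∀ ℓ : ℕ, ℓ.Prime → W.HasNonsingularReductionAt ℓ x y := by
    intro x y h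
    rw [hHdef, AddSubgroup.mem_inf, AddSubgroup.mem_comap, AddSubgroup.mem_iInf, mem_formalFiltration_iff]
    have hι : W.toPadicPoint p (.some x y h) = .some (x : ℚ_[p]) (y : ℚ_[p]) (nonsingular_ratCast h) :=
      toPadicPoint_some h
    rw [hι]
    constructor
    · rintro ⟨⟨hx, hz⟩, hns⟩
      refine ⟨⟨hx, hz⟩, fun ℓ hℓ => ?_⟩
      haveI : Fact ℓ.Prime := ⟨hℓ⟩
      exact (mem_nonsingularReductionSubgroupAt_iff _).mp (hns ⟨ℓ, hℓ⟩)
    · rintro ⟨⟨hx, hz⟩, hns⟩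
      exact ⟨⟨hx, hz⟩, fun ℓ => by
        haveI : Fact ℓ.1.Prime := ⟨ℓ.2⟩
        exact (mem_nonsingularReductionSubgroupAt_iff _).mpr (hns ℓ.1 ℓ.2)⟩
  -- `H` is torsion-free (odd `p`)
  have htf : ∀ P ∈ H, IsOfFinAddOrder P → P = 0 := by
    intro P hP hfin
    rcases P with _ | ⟨x, y, h⟩
    · rfl
    · exact (not_isOfFinAddOrder_of_one_lt_padicNorm_holds W p hp3 h ((hmem_some h).mp hP).1.1 hfin).elim
  set q : W.toAffine.Point → ℚ_[p] := CensusX42.sigmaHeight W p ((W.baseChange ℚ_[p]).formalSigma c) with hq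
  -- the parallelogram law on generic pairs of `H`
  have hgen : ∀ P ∈ H, ∀ Q ∈ H, P ≠ 0 → Q ≠ 0 → P - Q ≠ 0 → P + Q ≠ 0 →
      q (P + Q) + q (P - Q) = 2 * q P + 2 * q Q := by
    intro P hP Q hQ hP0 hQ0 hsub hadd
    have hS' : P + Q ∈ H := H.add_mem hP hQ
    have hD' : P - Q ∈ H := H.sub_mem hP hQ
    rcases P with _ | ⟨x₁, y₁, h₁⟩
    · exact (hP0 rfl).elim
    rcases Q with _ | ⟨x₂, y₂, h₂⟩
    · exact (hQ0 rfl).elim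
    have hx : x₁ ≠ x₂ := X_ne_of_sub_ne_zero_of_add_ne_zero h₁ h₂ hsub hadd
    rcases hS : (.some x₁ y₁ h₁ : W.toAffine.Point) + .some x₂ y₂ h₂ with _ | ⟨x₃, y₃, h₃⟩
    · exact (hadd hS).elim
    rcases hD : (.some x₁ y₁ h₁ : W.toAffine.Point) - .some x₂ y₂ h₂ with _ | ⟨x₄, y₄, h₄⟩
    · exact (hsub hD).elim
    rw [hS] at hS'
    rw [hD] at hD'
    obtain ⟨⟨hx₁, hz₁⟩, -⟩ := (hmem_some h₁).mp hP
    obtain ⟨⟨hx₂, hz₂⟩, hns₂⟩ := (hmem_some h₂).mp hQ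
    obtain ⟨⟨hx₃, hz₃⟩, -⟩ := (hmem_some h₃).mp hS'
    obtain ⟨⟨hx₄, hz₄⟩, -⟩ := (hmem_some h₄).mp hD'
    have d₁ := deep_of_mem_filtration W (nonsingular_ratCast (p := p) h₁).1 hx₁ hz₁
    have d₂ := deep_of_mem_filtration W (nonsingular_ratCast (p := p) h₂).1 hx₂ hz₂
    have d₃ := deep_of_mem_filtration W (nonsingular_ratCast (p := p) h₃).1 hx₃ hz₃
    have d₄ := deep_of_mem_filtration W (nonsingular_ratCast (p := p) h₄).1 hx₄ hz₄
    rw [hq, hS, hD]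
    exact sigmaHeight_formalSigma_parallelogram W hc h₁ h₂ h₃ h₄ hx hS hD d₁ d₂ d₃ d₄ hns₂
  have hfull := Literature.NumberTheory.EllipticCurves.parallelogram_of_generic H htf q rfl hgen
  obtain ⟨B, hsymm, htors, hdiag⟩ := Literature.NumberTheory.EllipticCurves.exists_pairing_of_parallelogram H q hfull
  refine ⟨⟨B, hsymm, fun P Q hP => htors P Q hP⟩, ?_⟩
  intro x y h hx hz hns
  exact hdiag _ ((hmem_some h).mpr ⟨⟨hx, hz⟩, hns⟩)

end Summit.BirchSwinnertonDyer.BirchSwinnertonDyer.Theorems.PSSigmaLineFamilyHeightDatum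

end
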